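import Summits.QuantumFields.YangMills.Theorems.LuscherReductionTwistedTraceScalingBOStiffQuasimodeAtom
import HarnessLib

/-!
# (B-ST) (W1-10 (A5)) `…BOStiffQuasimodeJump`: the profile-weighted MODEL JUMP MASS is two-sided close to the quasimode level, `cIk = (1±2σ)·(λ/cA)·cZ`
# (lane A of S-BASE, crux `TwistedTraceScaling` stmt-QuantumFields-20203, C4-CORE, the (B-ST) pen; lead g22 22:27Z request (A5))

From ✓`quasimode_model_full` (the two-sided slice bounds for the model jump `cK` at level `λ/cA`, the ring clause) and the abstract Rayleigh sandwich ✓`rayleigh_two_sided`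
(with `M := cK`): ★★ `quasimode_model_jump` — for `M ≥ M₀`, `0 < σ ≤ 1/4`, eventually in `β`, with the SAME `λ` as (Q±): `(1−σ)²·(λ/cA)·cZ ≤ cIk ≤ (1+σ)·(λ/cA)·cZ`
together with (Q±) for `cM`, (Q±) for `cK`, the ring clause and `0 < cZ`.
HONEST FRAMING: bookkeeping for a stub of a child of the CONDITIONAL route R2b1; (B-ST), C4-CORE OPEN; not infinite volume, not a gap, not Clay.
-/

set_option autoImplicit false

noncomputable section

open MeasureTheory Filter Topology Real
open scoped BigOperators RealInnerProductSpace NNReal ENNReal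
open Literature.MathematicalPhysics.QuantumFieldTheory
open Literature.MathematicalPhysics.QuantumLattice

namespace Summit.QuantumFields.YangMills.Theorems.FemtoTransferGap.TwoLattice.ConstTube

open Summit.QuantumFields.YangMills.Theorems.FemtoTransferGap
open Summit.QuantumFields.YangMills.Theorems.FemtoTransferGap.TwoLattice
open Summit.QuantumFields.YangMills.Theorems.FemtoTransferGap.TwoLattice.Stiff
open Summit.QuantumFields.YangMills.Theorems.FemtoTransferGap.TwoLattice.GnChart
open Summit.QuantumFields.YangMills.Theorems.FemtoTransferGap.TwoLattice.Avg

variable {L : ℕ} [NeZero L]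

/-- `cIk = ∫ cΘ(x)·(∫ cK(x,y)cΘ(y)dπ(y)) dπ(x)`. [folklore] -/
theorem cIk_eq_integral_profile (β : ℝ) :
    cIk L β = ∫ x, cΘ L β x * ∫ y, cK L β x y * cΘ L β y ∂orthoTransverse L ∂orthoTransverse L := by
  unfold cIk
  refine integral_congr_ae (ae_of_all _ fun x => ?_)
  simp only
  rw [← integral_const_mul]
  exact integral_congr_ae (ae_of_all _ fun y => by ring)

/-- ★★ **(A5) THE MODEL JUMP MASS AT THE QUASIMODE LEVEL**: for `1/6 < s < 1/4` there is `M₀ ≥ 2` such that for `M ≥ M₀`, `0 < σ ≤ 1/4`, eventually in `β`, with ONE `λ > 0`: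
(Q±) for `cM` at level `λ`, (Q±) for `cK` at level `λ/cA` (upper on `cS`, lower on `I = cS ∩ {‖x̂‖ ≤ r_f/12}`), the ring clause, `0 < cZ`, and
`(1−σ)²·(λ/cA)·cZ ≤ cIk ≤ (1+σ)·(λ/cA)·cZ`. [cite: Luscher1983, §3] -/
theorem quasimode_model_jump (hLz : Nonempty (NzSite L)) (hL2 : 2 ≤ L) {s : ℝ} (hs6 : 1 / 6 < s) (hs4 : s < 1 / 4) :
    ∃ M₀ : ℝ, 2 ≤ M₀ ∧ ∀ M : ℝ, M₀ ≤ M → ∀ σ : ℝ, 0 < σ → σ ≤ 1 / 4 → ∀ᶠ β : ℝ in atTop, ∃ lam : ℝ, 0 < lam ∧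
      0 < cZ L s M β ∧
      (∀ x ∈ cS L β, ∫ y, cM L β x y * cΘ L β y ∂orthoTransverse L ≤ (1 + σ) * lam * (cΘ L β x * cW L s M β x)) ∧
      (∀ x ∈ cS L β, ‖linkEmbed L x‖ ≤ min (1 / 40) (powScale (1 / 2) β * btLog β) / 12 →
        (1 - σ) * lam * (cΘ L β x * cW L s M β x) ≤ ∫ y, cM L β x y * cΘ L β y ∂orthoTransverse L) ∧
      (∀ x ∈ cS L β, ∫ y, cK L β x y * cΘ L β y ∂orthoTransverse L ≤ (1 + σ) * (lam / cA L β) * (cΘ L β x * cW L s M β x)) ∧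
      (∀ x ∈ cS L β, ‖linkEmbed L x‖ ≤ min (1 / 40) (powScale (1 / 2) β * btLog β) / 12 →
        (1 - σ) * (lam / cA L β) * (cΘ L β x * cW L s M β x) ≤ ∫ y, cK L β x y * cΘ L β y ∂orthoTransverse L) ∧
      ∫ x in cS L β \ (cS L β ∩ {x | ‖linkEmbed L x‖ ≤ min (1 / 40) (powScale (1 / 2) β * btLog β) / 12}), cΘ L β x ^ 2 * cW L s M β x ∂orthoTransverse L ≤
        σ * cZ L s M β ∧
      (1 - σ) ^ 2 * (lam / cA L β) * cZ L s M β ≤ cIk L β ∧ cIk L β ≤ (1 + σ) * (lam / cA L β) * cZ L s M β := by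
  haveI := isFiniteMeasure_orthoTransverse L
  obtain ⟨M₀, hM₀, H⟩ := quasimode_model_full (L := L) hLz hL2 hs6 hs4
  refine ⟨M₀, hM₀, fun M hM σ hσ hσ4 => ?_⟩
  filter_upwards [H M hM σ hσ, eventually_ge_atTop (0 : ℝ)] with β hβ hβ0
  obtain ⟨lam, hlam, hZ, hQp, hQm, hKp, hKm, hring⟩ := hβ
  obtain ⟨-, -, -, -, hΘm, hΘ1, hΘ0, hΘS, hSm⟩ := central_kform_data (L := L) hβ0
  obtain ⟨hWm, hWb, hW0⟩ := cW_props (L := L) s M β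
  have hcA : 0 < cA L β := by unfold cA; exact mul_pos (by positivity) (fpWeightBar_pos L (powScale_pos _ _))
  have hIm : MeasurableSet (cS L β ∩ {x | ‖linkEmbed L x‖ ≤ min (1 / 40) (powScale (1 / 2) β * btLog β) / 12}) :=
    hSm.inter (measurableSet_le (measurable_linkEmbed L).norm measurable_const)
  have hKb : ∀ x y, |cK L β x y| ≤ 1 := fun x y => by
    obtain ⟨h0, h1⟩ := cK_pos_le_one (L := L) hβ0 x y; rw [abs_of_pos h0]; exact h1
  obtain ⟨hlo, hhi⟩ := rayleigh_two_sided (μ := orthoTransverse L) (M := cK L β) (Θ := cΘ L β) (w := cW L s M β) (S := cS L β)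
    (I := cS L β ∩ {x | ‖linkEmbed L x‖ ≤ min (1 / 40) (powScale (1 / 2) β * btLog β) / 12})
    (measurable_cK (L := L) β) hKb (fun x y => (cK_pos_le_one (L := L) hβ0 x y).1.le) hΘm hΘ1 hΘ0 hΘS hSm hIm Set.inter_subset_left hWm hWb hW0
    (div_pos hlam hcA) hσ4 hKp (fun x hx => hKm x hx.1 hx.2) hring
  refine ⟨lam, hlam, hZ, hQp, hQm, hKp, hKm, hring, ?_, ?_⟩
  · rw [cIk_eq_integral_profile]; exact hlo
  · rw [cIk_eq_integral_profile]; exact hhi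

end Summit.QuantumFields.YangMills.Theorems.FemtoTransferGap.TwoLattice.ConstTube

end
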